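import Mathlib

/-!
# T5EpsilonTwist — the algebra behind (T1)–(T3) of route/T5-CHECK-G-p7.md §4 ([R-4], Tate half)

The three ε-factor identities used by CHECK-G §3 S3 (route-3 §G, register line [R-4]) are derived in
CHECK-G §4 from the PRINTED formulas of Kudla, «Tate's thesis» (An Introduction to the Langlands
Program, Birkhäuser), Prop. 3.8 (i)–(iv), (3.28), (3.29).  This file kernel-checks the DERIVATIONS:
the printed formulas enter as the definition of a *shape* (`epsShape`) or as hypotheses, and nothing
analytic — no integral, no Gauss sum, no ε-factor — is defined or proved here.

* `cond`      — the conductor exponent a(ω) = inf {m | ω ≡ 1 on U_m} along an antitone filtration.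
* `epsShape`  — Kudla Prop. 3.8 (i)/(ii) as a shape:
  ε(s, ω, ψ) = ω(ϖ^{n+a(ω)}) · q^{(½−s)(n+a(ω))} · 𝔤(ω|_U), with 𝔤 an arbitrary function of the
  restriction of ω to the units (𝔤 = 1 in the unramified case (i) is a hypothesis where needed).
* (T2) `epsShape_mul_of_unramified` — μ trivial on the units ⇒ ε(s, ημ, ψ) = μ(ϖ)^{n+a(η)} · ε(s, η, ψ).
* (T1) `epsShape_mul_epsShape_inv` — ε(s, ω, ψ) · ε(1−s, ω⁻¹, ψ) = ω(−1), GIVEN the Gauss-sum identity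
  𝔤(ω|_U) · 𝔤(ω⁻¹|_U) = ω(−1) (the analytic input of CHECK-G §4: the substitution y ↦ −y and
  Plancherel); what is checked is the cancellation of the ω(ϖ^k)- and q-power factors.
  `epsShape_mul_epsShape_inv_of_unramified` — the unramified case needs only 𝔤(1) = 1.
* (T3) `phase_pow_eq_conj_zpow_mul_norm_pow` / `phase_zpow_neg_eq` — the exponent identities
  (z/|z|)^N = z̄^{−N} |z|^N and (z/|z|)^{−N} = z^{−N} |z|^N on ℂ^×, packaged as identities of
  characters (`unitChar N = chiAB 0 N * normPow N`, resp. `chiAB N 0 * normPow N`), and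
  `epsC_unitChar` — ε(s, (z/|z|)^N, ψ_ℂ) = i^{|N|} for every N : ℤ, from Prop. 3.8 (iv) and (3.28)
  taken as hypotheses on an abstract archimedean ε.

Conventions: `Kx` is an abstract commutative group (the multiplicative group of the local field),
`U` the units, `ϖ` a uniformiser, `q` the residue cardinality, `n` the exponent of the additive
character, `m1` the image of −1.  On ℂ, |x|_ℂ = x x̄ = ‖x‖², so Kudla's ω_t(x) = |x|_ℂ^t at t = N/2 is
x ↦ ‖x‖^N (`normPow N`), and his ω(x) = x^{−a} x̄^{−b} is `chiAB a b`.
-/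

namespace Summit.Ventures.HodgeRepro2.T5EpsilonTwist

open Complex

section NonArchimedean

variable {Kx : Type*} [CommGroup Kx]

/-- The conductor exponent of `ω` along an antitone filtration `Ufil : ℕ → Subgroup Kx`
(`Ufil 0` = the units): the least `m` with `ω` trivial on `Ufil m`; junk value `0` if none. -/
noncomputable def cond (Ufil : ℕ → Subgroup Kx) (ω : Kx →* ℂˣ) : ℕ :=
  sInf {m : ℕ | Ufil m ≤ ω.ker}

/-- Kudla, «Tate's thesis», Prop. 3.8 (i)/(ii) as a SHAPE: with `c ω` the conductor exponent and
`G` the Gauss sum as a function of the restriction to the units,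
`ε(s, ω, ψ) = ω(ϖ^{n + c ω}) · q^{(1/2 − s)(n + c ω)} · G(ω|_U)`. -/
noncomputable def epsShape (U : Subgroup Kx) (ϖ : Kx) (q : ℂ) (n : ℤ)
    (c : (Kx →* ℂˣ) → ℕ) (G : (U →* ℂˣ) → ℂ) (s : ℂ) (ω : Kx →* ℂˣ) : ℂ :=
  ((ω (ϖ ^ (n + (c ω : ℤ))) : ℂˣ) : ℂ) * q ^ ((1 / 2 - s) * ((n : ℂ) + (c ω : ℂ))) *
    G (ω.restrict U)

/-- Twisting by a character trivial on `U` does not change the restriction to `U`. -/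
theorem restrict_mul_of_forall_eq_one {U : Subgroup Kx} {η μ : Kx →* ℂˣ}
    (hμ : ∀ u ∈ U, μ u = 1) : (η * μ).restrict U = η.restrict U := by
  ext u
  simp only [MonoidHom.restrict_apply, MonoidHom.mul_apply, hμ u u.2, mul_one]

/-- The kernel of `η * μ` meets `Ufil m` exactly where the kernel of `η` does, if `μ` is trivial
on `Ufil 0 ⊇ Ufil m`. -/
theorem le_ker_mul_iff {Ufil : ℕ → Subgroup Kx} (hanti : Antitone Ufil) {η μ : Kx →* ℂˣ}
    (hμ : ∀ u ∈ Ufil 0, μ u = 1) (m : ℕ) :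
    Ufil m ≤ (η * μ).ker ↔ Ufil m ≤ η.ker := by
  constructor
  · intro h u hu
    have h1 : (η * μ) u = 1 := MonoidHom.mem_ker.1 (h hu)
    have h2 : μ u = 1 := hμ u (hanti (Nat.zero_le m) hu)
    rw [MonoidHom.mul_apply, h2, mul_one] at h1
    exact MonoidHom.mem_ker.2 h1
  · intro h u hu
    have h1 : η u = 1 := MonoidHom.mem_ker.1 (h hu)
    have h2 : μ u = 1 := hμ u (hanti (Nat.zero_le m) hu)
    exact MonoidHom.mem_ker.2 (by rw [MonoidHom.mul_apply, h1, h2, mul_one])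

/-- Twisting by an unramified character (trivial on `Ufil 0`) keeps the conductor exponent:
the step «twisting by an unramified character keeps the conductor exponent» of CHECK-G §12.2 row P1.7. -/
theorem cond_mul_of_unramified {Ufil : ℕ → Subgroup Kx} (hanti : Antitone Ufil)
    {η μ : Kx →* ℂˣ} (hμ : ∀ u ∈ Ufil 0, μ u = 1) :
    cond Ufil (η * μ) = cond Ufil η := by
  unfold cond
  congr 1
  ext m
  exact le_ker_mul_iff hanti hμ m

/-- (T2), as derived in CHECK-G §4 from Prop. 3.8 (i)/(ii): for `μ` unramified (trivial on the units
`U = Ufil 0`) and any `η`, `ε(s, ημ, ψ) = μ(ϖ)^{n + a(η)} · ε(s, η, ψ)` — the conductor is unchanged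
(`cond_mul_of_unramified`), the Gauss sum is unchanged (`restrict_mul_of_forall_eq_one`), and
`(ημ)(ϖ^k) = η(ϖ^k) μ(ϖ)^k`. -/
theorem epsShape_mul_of_unramified (U : Subgroup Kx) {Ufil : ℕ → Subgroup Kx} (hU0 : Ufil 0 = U)
    (hanti : Antitone Ufil) (ϖ : Kx) (q : ℂ) (n : ℤ) (G : (U →* ℂˣ) → ℂ) (s : ℂ)
    {η μ : Kx →* ℂˣ} (hμ : ∀ u ∈ U, μ u = 1) :
    epsShape U ϖ q n (cond Ufil) G s (η * μ)
      = ((μ ϖ : ℂˣ) : ℂ) ^ (n + (cond Ufil η : ℤ)) * epsShape U ϖ q n (cond Ufil) G s η := by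
  have hμ0 : ∀ u ∈ Ufil 0, μ u = 1 := by rw [hU0]; exact hμ
  have hc : cond Ufil (η * μ) = cond Ufil η := cond_mul_of_unramified hanti hμ0
  unfold epsShape
  rw [hc, restrict_mul_of_forall_eq_one hμ, MonoidHom.mul_apply, Units.val_mul, map_zpow η,
    map_zpow μ, Units.val_zpow_eq_zpow_val, Units.val_zpow_eq_zpow_val]
  ring

/-- (T1), as derived in CHECK-G §4: `ε(s, ω, ψ) · ε(1 − s, ω⁻¹, ψ) = ω(−1)`, GIVEN that the conductor
of `ω⁻¹` is that of `ω` and the Gauss-sum identity `𝔤(ω|_U) 𝔤(ω⁻¹|_U) = ω(−1)` (the analytic input);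
the factors `ω(ϖ^k) · ω⁻¹(ϖ^k)` and `q^{(½−s)k} · q^{(½−(1−s))k}` cancel. -/
theorem epsShape_mul_epsShape_inv (U : Subgroup Kx) (ϖ : Kx) {q : ℂ} (hq : q ≠ 0) (n : ℤ)
    (c : (Kx →* ℂˣ) → ℕ) (G : (U →* ℂˣ) → ℂ) (s : ℂ) (ω : Kx →* ℂˣ) (m1 : Kx)
    (hc : c ω⁻¹ = c ω)
    (hG : G (ω.restrict U) * G (ω⁻¹.restrict U) = ((ω m1 : ℂˣ) : ℂ)) :
    epsShape U ϖ q n c G s ω * epsShape U ϖ q n c G (1 - s) ω⁻¹ = ((ω m1 : ℂˣ) : ℂ) := by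
  unfold epsShape
  rw [hc, MonoidHom.inv_apply, Units.val_inv_eq_inv_val]
  have hpow : q ^ ((1 / 2 - s) * ((n : ℂ) + (c ω : ℂ))) *
      q ^ ((1 / 2 - (1 - s)) * ((n : ℂ) + (c ω : ℂ))) = 1 := by
    rw [← Complex.cpow_add _ _ hq]
    have h0 : (1 / 2 - s) * ((n : ℂ) + (c ω : ℂ)) + (1 / 2 - (1 - s)) * ((n : ℂ) + (c ω : ℂ)) = 0 := by
      ring
    rw [h0, Complex.cpow_zero]
  have hne : ((ω (ϖ ^ (n + (c ω : ℤ))) : ℂˣ) : ℂ) ≠ 0 := Units.ne_zero _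
  calc ((ω (ϖ ^ (n + (c ω : ℤ))) : ℂˣ) : ℂ) * q ^ ((1 / 2 - s) * ((n : ℂ) + (c ω : ℂ))) *
        G (ω.restrict U) *
        ((((ω (ϖ ^ (n + (c ω : ℤ))) : ℂˣ) : ℂ))⁻¹ *
          q ^ ((1 / 2 - (1 - s)) * ((n : ℂ) + (c ω : ℂ))) * G (ω⁻¹.restrict U))
      = (((ω (ϖ ^ (n + (c ω : ℤ))) : ℂˣ) : ℂ) * (((ω (ϖ ^ (n + (c ω : ℤ))) : ℂˣ) : ℂ))⁻¹) *
          (q ^ ((1 / 2 - s) * ((n : ℂ) + (c ω : ℂ))) *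
            q ^ ((1 / 2 - (1 - s)) * ((n : ℂ) + (c ω : ℂ)))) *
          (G (ω.restrict U) * G (ω⁻¹.restrict U)) := by ring
    _ = ((ω m1 : ℂˣ) : ℂ) := by rw [mul_inv_cancel₀ hne, hpow, hG, one_mul, one_mul]

/-- The restriction of `ω⁻¹` to `U` is trivial when that of `ω` is. -/
theorem restrict_inv_eq_one {U : Subgroup Kx} {ω : Kx →* ℂˣ} (h : ω.restrict U = 1) :
    ω⁻¹.restrict U = 1 := by
  ext u
  have hu : ω u = 1 := by
    have := congrArg (fun f : U →* ℂˣ => f u) h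
    simpa [MonoidHom.restrict_apply] using this
  simp [MonoidHom.restrict_apply, MonoidHom.inv_apply, hu]

/-- (T1) in the unramified case (Prop. 3.8 (i)): `c ω = c ω⁻¹ = 0`, `ω` trivial on `U`, `𝔤(1) = 1`,
`m1 ∈ U` ⇒ `ε(s, ω, ψ) ε(1 − s, ω⁻¹, ψ) = 1 = ω(−1)`. -/
theorem epsShape_mul_epsShape_inv_of_unramified (U : Subgroup Kx) (ϖ : Kx) {q : ℂ} (hq : q ≠ 0)
    (n : ℤ) (c : (Kx →* ℂˣ) → ℕ) (G : (U →* ℂˣ) → ℂ) (hG1 : G 1 = 1) (s : ℂ) (ω : Kx →* ℂˣ)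
    (hω : ω.restrict U = 1) (hc : c ω⁻¹ = c ω) (m1 : Kx) (hm1 : m1 ∈ U) :
    epsShape U ϖ q n c G s ω * epsShape U ϖ q n c G (1 - s) ω⁻¹ = 1 ∧ ω m1 = 1 := by
  have hωm1 : ω m1 = 1 := by
    have := congrArg (fun f : U →* ℂˣ => f ⟨m1, hm1⟩) hω
    simpa [MonoidHom.restrict_apply] using this
  refine ⟨?_, hωm1⟩
  have hG : G (ω.restrict U) * G (ω⁻¹.restrict U) = ((ω m1 : ℂˣ) : ℂ) := by
    rw [hω, restrict_inv_eq_one hω, hG1, hωm1, one_mul, Units.val_one]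
  rw [epsShape_mul_epsShape_inv U ϖ hq n c G s ω m1 hc hG, hωm1, Units.val_one]

end NonArchimedean

section Archimedean

/-- The phase `z ↦ z/|z|` as a character of `ℂˣ`. -/
noncomputable def phase : ℂˣ →* ℂˣ where
  toFun z := Units.mk0 ((z : ℂ) / (‖(z : ℂ)‖ : ℂ))
    (div_ne_zero z.ne_zero (by exact_mod_cast norm_ne_zero_iff.2 z.ne_zero))
  map_one' := by ext; simp
  map_mul' x y := by
    ext
    simp only [Units.val_mk0, Units.val_mul, norm_mul, Complex.ofReal_mul]
    rw [div_mul_div_comm]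

/-- Value of `phase`: `z/|z|`. -/
@[simp] theorem phase_apply (z : ℂˣ) : ((phase z : ℂˣ) : ℂ) = (z : ℂ) / (‖(z : ℂ)‖ : ℂ) := rfl

/-- Kudla's `ω_t(x) = |x|_ℂ^t` at `t = N/2`: since `|x|_ℂ = x x̄ = ‖x‖²`, this is `x ↦ ‖x‖^N`. -/
noncomputable def normPow (N : ℕ) : ℂˣ →* ℂˣ where
  toFun z := Units.mk0 ((‖(z : ℂ)‖ : ℂ) ^ N)
    (pow_ne_zero _ (by exact_mod_cast norm_ne_zero_iff.2 z.ne_zero))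
  map_one' := by ext; simp
  map_mul' x y := by
    ext
    simp only [Units.val_mk0, Units.val_mul, norm_mul, Complex.ofReal_mul, mul_pow]

/-- Value of `normPow N`: `‖z‖^N`. -/
@[simp] theorem normPow_apply (N : ℕ) (z : ℂˣ) :
    ((normPow N z : ℂˣ) : ℂ) = (‖(z : ℂ)‖ : ℂ) ^ N := rfl

/-- Complex conjugation on `ℂˣ`. -/
noncomputable def conjU : ℂˣ →* ℂˣ := Units.map (starRingEnd ℂ).toMonoidHom

/-- Value of `conjU`: complex conjugation. -/
@[simp] theorem conjU_apply (z : ℂˣ) : ((conjU z : ℂˣ) : ℂ) = starRingEnd ℂ (z : ℂ) := rfl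

/-- Kudla's `ω(x) = x^{−a} x̄^{−b}` (Prop. 3.8 (iv)), as a character of `ℂˣ`. -/
noncomputable def chiAB (a b : ℕ) : ℂˣ →* ℂˣ :=
  zpowGroupHom (-(a : ℤ)) * (zpowGroupHom (-(b : ℤ))).comp conjU

/-- Value of `chiAB a b`: `z^{−a} · z̄^{−b}`. -/
theorem chiAB_apply (a b : ℕ) (z : ℂˣ) :
    ((chiAB a b z : ℂˣ) : ℂ) = (z : ℂ) ^ (-(a : ℤ)) * (starRingEnd ℂ (z : ℂ)) ^ (-(b : ℤ)) := by
  simp [chiAB, zpowGroupHom]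

/-- The character `z ↦ (z/|z|)^N` of `ℂˣ` (the archimedean component of the S3 characters). -/
noncomputable def unitChar (N : ℤ) : ℂˣ →* ℂˣ := (zpowGroupHom N).comp phase

/-- Value of `unitChar N`: `(z/|z|)^N`. -/
theorem unitChar_apply (N : ℤ) (z : ℂˣ) :
    ((unitChar N z : ℂˣ) : ℂ) = ((z : ℂ) / (‖(z : ℂ)‖ : ℂ)) ^ N := by
  simp [unitChar, zpowGroupHom, Units.val_zpow_eq_zpow_val]

/-- `z/|z| = |z|/z̄` for `z ≠ 0` (from `z z̄ = |z|²`). -/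
theorem div_norm_eq_norm_div_conj {z : ℂ} (hz : z ≠ 0) :
    z / (‖z‖ : ℂ) = (‖z‖ : ℂ) / starRingEnd ℂ z := by
  have hn : (‖z‖ : ℂ) ≠ 0 := by exact_mod_cast norm_ne_zero_iff.2 hz
  have hc : starRingEnd ℂ z ≠ 0 := (map_ne_zero _).2 hz
  rw [div_eq_div_iff hn hc, Complex.mul_conj', sq]

/-- (T3), exponent identity: `(z/|z|)^N = z̄^{−N} |z|^N` for `N ≥ 0`, as characters:
`unitChar N = chiAB 0 N * normPow N`. -/
theorem unitChar_natCast (N : ℕ) : unitChar (N : ℤ) = chiAB 0 N * normPow N := by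
  ext z
  rw [MonoidHom.mul_apply, Units.val_mul, unitChar_apply, chiAB_apply, normPow_apply]
  have hz : (z : ℂ) ≠ 0 := z.ne_zero
  have hc : starRingEnd ℂ (z : ℂ) ≠ 0 := (map_ne_zero _).2 hz
  rw [div_norm_eq_norm_div_conj hz, zpow_natCast, div_pow, Nat.cast_zero, neg_zero, zpow_zero,
    one_mul, zpow_neg, zpow_natCast, div_eq_inv_mul]

/-- (T3), exponent identity for `N ≤ 0`: `(z/|z|)^{−N} = z^{−N} |z|^N`, as characters:
`unitChar (−N) = chiAB N 0 * normPow N`. -/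
theorem unitChar_neg_natCast (N : ℕ) : unitChar (-(N : ℤ)) = chiAB N 0 * normPow N := by
  ext z
  rw [MonoidHom.mul_apply, Units.val_mul, unitChar_apply, chiAB_apply, normPow_apply]
  have hz : (z : ℂ) ≠ 0 := z.ne_zero
  rw [zpow_neg, zpow_natCast, div_pow, Nat.cast_zero, neg_zero, zpow_zero, mul_one, zpow_neg,
    zpow_natCast, inv_div, div_eq_inv_mul]

/-- (T3) as derived in CHECK-G §4: with Kudla's Prop. 3.8 (iv) (`h_iv`: `ε(s, x^{−a} x̄^{−b}, ψ_ℂ) = i^{max(a,b)}`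
for `min(a,b) = 0`) and (3.28) (`h_328`: `ε(s, ω·|·|_ℂ^{N/2}, ψ) = ε(s + N/2, ω, ψ)`) as hypotheses on an
abstract archimedean `ε`, `ε(s, (z/|z|)^N, ψ_ℂ) = i^{|N|}` for every `N : ℤ` — independent of `s`. -/
theorem epsC_unitChar (epsC : ℂ → (ℂˣ →* ℂˣ) → ℂ)
    (h_iv : ∀ a b : ℕ, min a b = 0 → ∀ s : ℂ, epsC s (chiAB a b) = I ^ (max a b))
    (h_328 : ∀ (s : ℂ) (ω : ℂˣ →* ℂˣ) (N : ℕ), epsC s (ω * normPow N) = epsC (s + N / 2) ω)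
    (s : ℂ) (N : ℤ) : epsC s (unitChar N) = I ^ N.natAbs := by
  obtain ⟨n, rfl | rfl⟩ := Int.eq_nat_or_neg N
  · rw [unitChar_natCast, h_328, h_iv 0 n (by simp), Int.natAbs_natCast]
    simp
  · rw [unitChar_neg_natCast, h_328, h_iv n 0 (by simp), Int.natAbs_neg, Int.natAbs_natCast]
    simp

end Archimedean

end Summit.Ventures.HodgeRepro2.T5EpsilonTwist
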